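import Literature.NumberTheory.ModularSymbols.CuspidalHomologyShiftNorm
import Literature.NumberTheory.EllipticCurves.NewformsLevelLowering
import Literature.NumberTheory.EllipticCurves.ModularCurveIharaLemma
import Literature.NumberTheory.EllipticCurves.NewformsMultiplicityOneProofs
import HarnessLib

/-!
# The norm `Nm = 1 + t + t²` of the shift factors through level `N/3`:
# `Nm = ι₃ ∘ π_*` on `S₂(Γ₀(N))`, `π_* ι₃ = 3`, and the transfer
# `H₁(X₀(N/3), ℤ) → H₁(X₀(N), ℤ)` (`9 ∣ N`; degeneracy-map dictionary for `CuspidalHomologyShiftNorm`)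

Topic `Literature/NumberTheory/ModularSymbols`, sequel to `CuspidalHomologyShiftNorm` (the norm
`Nm = 1 + t_* + t_*²` of the shift `t : τ ↦ τ + 1/3` on `V = S₂(Γ₀(N))^∨`, on
`Λ = H₁(X₀(N), ℤ) = periodHomologyHecke N` and the fixed lattice `Λ_B = ker(t_* − 1)`), whose module
docstring says: "`π^* π_* = 1 + t_* + t_*² =: Nm` … so the `π^*J₀(N/3)`-part and the Prym part are
visible on `X₀(N)` alone, WITHOUT degeneracy maps".  This file supplies the degeneracy maps: it
identifies `Nm` with the composite of the two classical level-changing maps of `Newforms.lean` for the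
cyclic triple cover `π : X₀(N) → X₀(N)/⟨t⟩ ≅ X₀(N/3)` (`9 ∣ N`), and transports the identification to
the integral period homology.  THEOREMS plus two bundled restrictions (`pushforwardInt`,
`transferInt`); no named fact, no instance, no `sorry`.

* **On cusp forms** (`ι₃ := degeneracyMap0 (N/3) N 3 2`, the pull-back `g ↦ g ∣ diag(3,1) = 3·g(3τ)`
  along `τ ↦ 3τ`; `π_* := adjDegeneracyMap0 N (N/3) 3 2`, the adjoint degeneracy map = trace, whose
  underlying function is `U₃ f = ∑ⱼ f ∣ (1 j; 0 3)` because `9 ∣ N` — Knapp, Lemma 9.26, first part,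
  the tree's `coe_adjDegeneracyMap0_of_sq_dvd`):
  `f + f∣t + f∣t² = ι₃ (π_* f)` (`add_shiftOp_add_shiftOp_shiftOp_eq`: both sides are
  `τ ↦ f(τ) + f(τ + 1/3) + f(τ + 2/3)`), `π_* (ι₃ g) = 3 • g` (`adjDegeneracyMap0_degeneracyMap0`),
  `(ι₃ g) ∣ t = ι₃ g` (`shiftOp_degeneracyMap0`), `π_* (f ∣ t) = π_* f` (`adjDegeneracyMap0_shiftOp`);
  hence `ι₃` is injective, and **a form of level `Γ₀(N)` is `t`-fixed iff it is `ι₃` of a form of level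
  `Γ₀(N/3)`** (`shiftOp_eq_self_iff_mem_range`; "`t`-invariant cusp forms are the forms in `q³`").
  This is the `H⁰(Ω¹)`-avatar of Lange–Rodríguez, Prop. 3.5.1: `Nm_G = f^* ∘ Nm_f` for a Galois cover
  `f` with group `G`, and of `Nm_f ∘ f^* = d` (op. cit. §3.2.1).
* **On the duals** `V = S₂(Γ₀(·))^∨`: `normDual N h9 = π_*^∨ ∘ ι₃^∨`
  (`normDual_eq_dualMap_dualMap`), `ι₃^∨ (π_*^∨ ψ) = 3 • ψ`, `π_*^∨` injective and `t_*`-fixed.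
* **Integrality of the transfer**: `π_*^∨` maps `H₁(X₀(N/3), ℤ)` into `H₁(X₀(N), ℤ)`
  (`dualMap_adjDegeneracyMap0_mem_periodHomology`): for `γ ∈ Γ₀(N/3)`,
  `{∞, γ∞}_{π_* f} = ∑_{j mod 3} {∞, δⱼ∞}_f` with `δⱼ ∈ Γ₀(N)` of first column
  `(a + jc, 3c)ᵀ` (`exists_gamma0_inftyImage_tpB_of_dvd`; here `3 ∣ c` because `9 ∣ N`, so
  `3 ∤ a + jc`) — Cremona's action of Heilbronn-type matrices on modular symbols, (2.4.1)–(2.4.2),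
  exactly as in the tree's `exists_cuspSymbol_heckeT`; `ι₃^∨` maps `H₁(X₀(N), ℤ)` to
  `H₁(X₀(N/3), ℤ)` by the tree's `dualMap_degeneracyMap0_mem_periodHomology`.
* **On `Λ = periodHomologyHecke`**: the restrictions `pushforwardInt N h3 : Λ_N →ₗ[ℤ] Λ_{N/3}` (`π_*` on
  `H₁`, `= ι₃^∨`) and `transferInt N h9 : Λ_{N/3} →ₗ[ℤ] Λ_N` (`π^*` on `H₁`, `= π_*^∨`) satisfy
  `transferInt (pushforwardInt x) = normInt x` (**`Nm = π^* π_*` on `H₁(X₀(N), ℤ)`**),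
  `pushforwardInt (transferInt y) = 3 • y`, `transferInt` is injective, `t_*`-fixed
  (`range transferInt ≤ fixedLattice`), `normInt (transferInt y) = 3 • transferInt y`; so
  `3 • π^*Λ_{N/3} ⊆ Nm Λ_N ⊆ π^*Λ_{N/3} ⊆ Λ_B` and `Nm Λ_N ≅ π_*Λ_N`, a sublattice of `Λ_{N/3}`
  containing `3Λ_{N/3}`; both maps intertwine `T_p` at levels `N` and `N/3` for `p ∤ N`
  (`pushforwardInt_smul_T`, `transferInt_smul_T`, from the tree's `heckeT_degeneracyMap0`,
  `adjDegeneracyMap0_heckeT`).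

This is the dictionary "`Nm Λ ↔ π_*Λ ⊆ H₁(X₀(N/3))` / `B = Nm J₀(N) ↔` forms of level `N/3`" asked for
by the cell `bsd-idea-3` (LINE 29, item H1 `TprimeIrrNormImageAvoidsThree`, "WHY IT MIGHT FAIL (a)")
and by the definition typer (2026-08-28): with it, the mod-`3` Hecke eigensystems of
`Nm Λ_N/(Nm Λ_N ∩ 3Λ_N)` are among those of `Λ_{N/3}/3Λ_{N/3}`, i.e. of weight `2` and level `N/3`.
Nothing about Galois representations, Serre weights or any elliptic curve is asserted here (the
weight bound at level `N/3`, `3 ∥ N/3`, is the tree's `serreWeight_le_add_one_of_weightTwo_newform`);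
the saturation `π^*Λ_{N/3} = Λ_B` (surjectivity of `π_*` on `H₁`, from the ramification of `π`) is
NOT proved and not needed by the consumer.  No summit statement is touched.  Statements at level
`N/3` carry the instance hypothesis `[NeZero (N / 3)]` (for `N ≠ 0`, `3 ∣ N` supply it with
`haveI : NeZero (N / 3) := ⟨(Nat.div_pos (Nat.le_of_dvd (NeZero.pos N) h3) three_pos).ne'⟩`).

## References

* H. Lange, R. E. Rodríguez, *Decomposition of Jacobians by Prym Varieties*, LNM 2310 (2022), §3.2.1
  (PDF p. 55: "`Nm_f ∘ f^* = d_J`"), Prop. 3.5.1 and Cor. 3.5.2 (a) (PDF p. 67: "`Nm_G = f^* ∘ Nm_f`",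
  "`Im f^* = {x | x = ∑_σ σ(y)}`"). [LangeRodriguez2022]
* A. W. Knapp, *Elliptic Curves*, Princeton Math. Notes 40 (1993), Lemma 9.26 (PDF p. 216: "If
  `p² ∣ N`, then `T_k(p) f` is in `S_k(Γ₀(N/p))`"). [Knapp1993]
* J. E. Cremona, *Algorithms for modular elliptic curves*, 2nd ed. (1997), §2.1 (Lemma 2.1.1), §2.4
  ((2.4.1)–(2.4.2): Hecke/Heilbronn matrices on modular symbols). [CremonaAlgorithms1997]
* F. Diamond, J. Shurman, *A First Course in Modular Forms* (2005), §5.2 ((5.2), Prop. 5.2.2), §5.6–5.7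
  (the maps `ι_d`, `[α_d]_k`), §6.1, §6.6. [DiamondShurman2005]
* M. Harrison, *A new automorphism of `X₀(108)`* (2011), §2 (the automorphism `S₃ : τ ↦ τ + 1/3`
  of `X₀(N)`, `9 ∣ N`). [Harrison2011X0108]
-/

noncomputable section

open scoped MatrixGroups ModularForm

open CongruenceSubgroup UpperHalfPlane
open Literature.NumberTheory.EllipticCurves.ModularForms

namespace Literature.NumberTheory.ModularSymbols

/-! ### Arithmetic of the level -/

section Level

variable (N : ℕ)

/-- `3 ∣ N` when `9 ∣ N`. [folklore] -/
private theorem three_dvd_of_nine_dvd (h9 : 3 ^ 2 ∣ N) : 3 ∣ N :=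
  (dvd_pow_self 3 two_ne_zero).trans h9

/-- `3 · 3 ∣ N` when `9 ∣ N` (the hypothesis shape of `coe_adjDegeneracyMap0_of_sq_dvd`). [folklore] -/
private theorem three_mul_three_dvd_of_nine_dvd (h9 : 3 ^ 2 ∣ N) : 3 * 3 ∣ N := by
  simpa [pow_two] using h9

/-- `3 ∣ N/3` when `9 ∣ N`. [folklore] -/
private theorem three_dvd_div_three_of_nine_dvd (h9 : 3 ^ 2 ∣ N) : 3 ∣ N / 3 :=
  Nat.dvd_div_of_mul_dvd (three_mul_three_dvd_of_nine_dvd N h9)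

/-- `(N/3) · 3 ∣ N` when `3 ∣ N` (the hypothesis shape `M d ∣ N` of the degeneracy maps, with
`M = N/3`, `d = 3`). [folklore] -/
private theorem div_three_mul_three_dvd (h3 : 3 ∣ N) : N / 3 * 3 ∣ N :=
  dvd_of_eq (Nat.div_mul_cancel h3)

end Level

/-! ### Points: the Heilbronn matrices `(1 j; 0 3)`, `diag(3, 1)` and the shift `τ ↦ τ + 1/3` -/

section Points

/-- `(1 j; 0 3) · (diag(3,1) · τ) = τ + j/3`. [folklore] -/
private theorem tpB_three_smul_tpD_three_smul (j : ℤ) (τ : ℍ) :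
    tpB 3 j • (tpD 3 • τ) = ((j : ℝ) / 3) +ᵥ τ := by
  apply UpperHalfPlane.ext
  rw [coe_tpB_smul, coe_tpD_smul, coe_vadd]
  push_cast
  ring

/-- `diag(3,1) · ((1 j; 0 3) · τ) = τ + j`. [folklore] -/
private theorem tpD_three_smul_tpB_three_smul (j : ℤ) (τ : ℍ) :
    tpD 3 • (tpB 3 j • τ) = (j : ℝ) +ᵥ τ := by
  apply UpperHalfPlane.ext
  rw [coe_tpD_smul, coe_tpB_smul, coe_vadd]
  push_cast
  ring

/-- `diag(3,1) · (τ + 1/3) = (diag(3,1) · τ) + 1`. [folklore] -/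
private theorem tpD_three_smul_third_vadd (τ : ℍ) :
    tpD 3 • (((1 : ℝ) / 3) +ᵥ τ) = (1 : ℝ) +ᵥ (tpD 3 • τ) := by
  apply UpperHalfPlane.ext
  rw [coe_tpD_smul, coe_vadd, coe_vadd, coe_tpD_smul]
  push_cast
  ring

/-- `((1 j; 0 3) · τ) + 1/3 = (1 (j+1); 0 3) · τ`. [folklore] -/
private theorem third_vadd_tpB_three_smul (j : ℤ) (τ : ℍ) :
    ((1 : ℝ) / 3) +ᵥ (tpB 3 j • τ) = tpB 3 (j + 1) • τ := by
  apply UpperHalfPlane.ext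
  rw [coe_vadd, coe_tpB_smul, coe_tpB_smul]
  push_cast
  ring

/-- `(1 3; 0 3) · τ = ((1 0; 0 3) · τ) + 1`. [folklore] -/
private theorem tpB_three_three_smul (τ : ℍ) : tpB 3 3 • τ = (1 : ℝ) +ᵥ (tpB 3 0 • τ) := by
  apply UpperHalfPlane.ext
  rw [coe_vadd, coe_tpB_smul, coe_tpB_smul]
  push_cast
  ring

/-- A cusp form of level `Γ₀(M)` is `1`-periodic: `g(τ + j) = g(τ)` for `j ∈ ℤ` (`T ∈ Γ₀(M)`; Mathlib
`SlashInvariantForm.vAdd_apply_of_mem_strictPeriods` with `strictWidthInfty_Gamma0`). [folklore] -/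
private theorem cuspForm_intCast_vadd (M : ℕ) {k : ℤ} (g : CuspForm (Gamma0 M) k) (j : ℤ) (τ : ℍ) :
    g ((j : ℝ) +ᵥ τ) = g τ := by
  have h1 : (1 : ℝ) ∈ (Gamma0 M : Subgroup (GL (Fin 2) ℝ)).strictPeriods :=
    strictWidthInfty_Gamma0 M ▸ Subgroup.strictWidthInfty_mem_strictPeriods _
  have hj : (j : ℝ) ∈ (Gamma0 M : Subgroup (GL (Fin 2) ℝ)).strictPeriods := by
    have h := AddSubgroup.zsmul_mem _ h1 j
    rwa [zsmul_one] at h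
  exact SlashInvariantForm.vAdd_apply_of_mem_strictPeriods g τ hj

end Points

/-! ### On cusp forms: `Nm = ι₃ ∘ π_*`, `π_* ι₃ = 3`, `t`-fixed forms are `3`-old -/

section Forms

variable (N : ℕ) [NeZero N] (h9 : 3 ^ 2 ∣ N)

/-- **The pull-back `ι₃ = degeneracyMap0 (N/3) N 3 2` pointwise**: `(ι₃ g)(τ) = 3 · g(3τ)`
(`= g ∣[2] diag(3,1) = d^{k-1} g(dτ)` with `d = 3`, `k = 2`; the tree's `coe_degeneracyMap0`; Diamond–Shurman
§5.6, the map `[α_d]_k`, p. 209). [cite: DiamondShurman2005, §5.6 p. 209] -/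
theorem degeneracyMap0_three_apply [NeZero (N / 3)] (h3 : 3 ∣ N) (g : CuspForm (Gamma0 (N / 3)) 2)
    (τ : ℍ) : degeneracyMap0 (N / 3) N 3 2 g τ = 3 * g (tpD 3 • τ) := by
  have h := congr_fun (coe_degeneracyMap0 (N / 3) N 3 2 (div_three_mul_three_dvd N h3) g) τ
  rw [h, slash_tpD_apply]
  norm_num

include h9 in
/-- **The trace `π_* = adjDegeneracyMap0 N (N/3) 3 2` pointwise** (`9 ∣ N`):
`(π_* f)(τ) = ∑_{j mod 3} 3⁻¹ f((τ + j)/3)`, i.e. `π_* f = U₃ f = ∑ⱼ f ∣ (1 j; 0 3)` as functions —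
Knapp, Lemma 9.26, first part ("If `p² ∣ N`, then `T_k(p) f` is in `S_k(Γ₀(N/p))`"), in the tree
`coe_adjDegeneracyMap0_of_sq_dvd` with `coe_heckeT_gamma0_eq_sum`.
[cite: Knapp1993, Lemma 9.26 (PDF p. 216)] -/
theorem adjDegeneracyMap0_three_apply [NeZero (N / 3)] (f : CuspForm (Gamma0 N) 2) (τ : ℍ) :
    adjDegeneracyMap0 N (N / 3) 3 2 f τ =
      ∑ j : Fin 3, (3 : ℂ)⁻¹ * f (tpB 3 ((j : ℕ) : ℤ) • τ) := by
  have h := congr_fun (coe_adjDegeneracyMap0_of_sq_dvd (N := N) (k := 2) Nat.prime_three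
    (three_mul_three_dvd_of_nine_dvd N h9) f) τ
  rw [h, coe_heckeT_gamma0_eq_sum N 2 3 Nat.prime_three f, if_pos (three_dvd_of_nine_dvd N h9),
    add_zero, Finset.sum_apply]
  refine Finset.sum_congr rfl fun j _ ↦ ?_
  rw [slash_tpB_apply]
  norm_num

/-- **`(ι₃ g) ∣ t = ι₃ g`**: forms pulled back from level `N/3` along `τ ↦ 3τ` (the forms "in `q³`")
are fixed by the shift `t : τ ↦ τ + 1/3`, since `3(τ + 1/3) = 3τ + 1` and `g` is `1`-periodic
(Lange–Rodríguez Cor. 3.5.2 (a): `Im f^*` is `G`-fixed). [cite: LangeRodriguez2022, Cor. 3.5.2 (a) (PDF p. 67)] -/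
theorem shiftOp_degeneracyMap0 [NeZero (N / 3)] (g : CuspForm (Gamma0 (N / 3)) 2) :
    shiftOp N h9 (degeneracyMap0 (N / 3) N 3 2 g) = degeneracyMap0 (N / 3) N 3 2 g := by
  have h3 : 3 ∣ N := three_dvd_of_nine_dvd N h9
  ext τ
  rw [shiftOp_apply, shiftCuspForm_apply, degeneracyMap0_three_apply N h3,
    degeneracyMap0_three_apply N h3, tpD_three_smul_third_vadd]
  have := cuspForm_intCast_vadd (N / 3) g 1 (tpD 3 • τ)
  rw [Int.cast_one] at this
  rw [this]

/-- **`Nm = ι₃ ∘ π_*` on `S₂(Γ₀(N))`, `9 ∣ N`: `f + f∣t + f∣t² = ι₃ (π_* f)`.**  Both sides are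
`τ ↦ f(τ) + f(τ + 1/3) + f(τ + 2/3)`: on the right, `(ι₃ (π_* f))(τ) = 3 · (π_* f)(3τ)
= ∑_{j mod 3} f((3τ + j)/3)`.  This is `Nm_G = f^* ∘ Nm_f` (Lange–Rodríguez, Prop. 3.5.1, stated there
on the Jacobian) read on holomorphic differentials = weight-two cusp forms, for the cyclic cover
`π : X₀(N) → X₀(N)/⟨t⟩ ≅ X₀(N/3)` (pull-back `ι₃`, trace `π_*`).
[cite: LangeRodriguez2022, Prop. 3.5.1 (PDF p. 67)] -/
theorem add_shiftOp_add_shiftOp_shiftOp_eq [NeZero (N / 3)] (f : CuspForm (Gamma0 N) 2) :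
    f + shiftOp N h9 f + shiftOp N h9 (shiftOp N h9 f) =
      degeneracyMap0 (N / 3) N 3 2 (adjDegeneracyMap0 N (N / 3) 3 2 f) := by
  have h3 : 3 ∣ N := three_dvd_of_nine_dvd N h9
  ext τ
  simp only [CuspForm.coe_add, Pi.add_apply, shiftOp_apply, shiftCuspForm_apply, vadd_vadd]
  rw [degeneracyMap0_three_apply N h3, adjDegeneracyMap0_three_apply N h9, Finset.mul_sum,
    Fin.sum_univ_three]
  simp only [Fin.val_zero, Fin.val_one, Fin.val_two, Nat.cast_zero, Nat.cast_one, Nat.cast_ofNat,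
    tpB_three_smul_tpD_three_smul, ← mul_assoc]
  norm_num

include h9 in
/-- **`π_* ∘ ι₃ = 3` on `S₂(Γ₀(N/3))`, `9 ∣ N`**: `π_* (ι₃ g) = 3 • g`, since
`(π_* (ι₃ g))(τ) = ∑_{j mod 3} 3⁻¹ · 3 · g(3 · (τ + j)/3) = ∑ⱼ g(τ + j) = 3 g(τ)` ("`Nm_f ∘ f^* = d`",
Lange–Rodríguez §3.2.1, on differentials). [cite: LangeRodriguez2022, §3.2.1 (PDF p. 55)] -/
theorem adjDegeneracyMap0_degeneracyMap0 [NeZero (N / 3)] (g : CuspForm (Gamma0 (N / 3)) 2) :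
    adjDegeneracyMap0 N (N / 3) 3 2 (degeneracyMap0 (N / 3) N 3 2 g) = (3 : ℂ) • g := by
  have h3 : 3 ∣ N := three_dvd_of_nine_dvd N h9
  ext τ
  rw [adjDegeneracyMap0_three_apply N h9, CuspForm.IsGLPos.smul_apply, smul_eq_mul]
  have hterm : ∀ j : Fin 3,
      (3 : ℂ)⁻¹ * degeneracyMap0 (N / 3) N 3 2 g (tpB 3 ((j : ℕ) : ℤ) • τ) = g τ := by
    intro j
    rw [degeneracyMap0_three_apply N h3, tpD_three_smul_tpB_three_smul, cuspForm_intCast_vadd,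
      ← mul_assoc]
    norm_num
  simp only [hterm, Finset.sum_const, Finset.card_univ, Fintype.card_fin, nsmul_eq_mul]
  norm_num

/-- **`π_* (f ∣ t) = π_* f`**: the trace is invariant under the deck transformation, since
`t · (1 j; 0 3) = (1 (j+1); 0 3)` permutes the three Heilbronn matrices modulo `Γ₀(N)`
(`(1 3; 0 3)·τ = (1 0; 0 3)·τ + 1`). [cite: LangeRodriguez2022, Prop. 3.5.1 (PDF p. 67)] -/
theorem adjDegeneracyMap0_shiftOp [NeZero (N / 3)] (f : CuspForm (Gamma0 N) 2) :
    adjDegeneracyMap0 N (N / 3) 3 2 (shiftOp N h9 f) = adjDegeneracyMap0 N (N / 3) 3 2 f := by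
  ext τ
  rw [adjDegeneracyMap0_three_apply N h9, adjDegeneracyMap0_three_apply N h9, Fin.sum_univ_three,
    Fin.sum_univ_three]
  simp only [shiftOp_apply, shiftCuspForm_apply, third_vadd_tpB_three_smul, Fin.val_zero,
    Fin.val_one, Fin.val_two, Nat.cast_zero, Nat.cast_one, Nat.cast_ofNat]
  have h3 : f (tpB 3 ((2 : ℤ) + 1) • τ) = f (tpB 3 0 • τ) := by
    rw [show (2 : ℤ) + 1 = 3 by norm_num, tpB_three_three_smul]
    have := cuspForm_intCast_vadd N f 1 (tpB 3 0 • τ)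
    rwa [Int.cast_one] at this
  rw [zero_add, show (1 : ℤ) + 1 = 2 by norm_num, h3]
  ring

include h9 in
/-- **`ι₃ : S₂(Γ₀(N/3)) → S₂(Γ₀(N))` is injective** (`π_* ι₃ = 3`). [cite: LangeRodriguez2022, §3.2.1 (PDF p. 55)] -/
theorem degeneracyMap0_three_injective [NeZero (N / 3)] :
    Function.Injective (degeneracyMap0 (N / 3) N 3 2) := by
  intro g₁ g₂ h
  have h' := congrArg (adjDegeneracyMap0 N (N / 3) 3 2) h
  rw [adjDegeneracyMap0_degeneracyMap0 N h9, adjDegeneracyMap0_degeneracyMap0 N h9] at h'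
  exact smul_right_injective _ (by norm_num : (3 : ℂ) ≠ 0) h'

include h9 in
/-- **`π_* : S₂(Γ₀(N)) → S₂(Γ₀(N/3))` is surjective** (`π_* (ι₃ (3⁻¹ g)) = g`). [cite: LangeRodriguez2022, §3.2.1 (PDF p. 55)] -/
theorem adjDegeneracyMap0_three_surjective [NeZero (N / 3)] :
    Function.Surjective (adjDegeneracyMap0 N (N / 3) 3 2) := fun g ↦
  ⟨degeneracyMap0 (N / 3) N 3 2 ((3 : ℂ)⁻¹ • g), by
    rw [map_smul, map_smul, adjDegeneracyMap0_degeneracyMap0 N h9, smul_smul]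
    norm_num⟩

/-- A `t`-fixed form satisfies `3 • f = ι₃ (π_* f)`. [cite: LangeRodriguez2022, Cor. 3.5.2 (a) (PDF p. 67)] -/
theorem three_smul_eq_degeneracyMap0_of_shiftOp_eq [NeZero (N / 3)] {f : CuspForm (Gamma0 N) 2}
    (hf : shiftOp N h9 f = f) :
    (3 : ℂ) • f = degeneracyMap0 (N / 3) N 3 2 (adjDegeneracyMap0 N (N / 3) 3 2 f) := by
  rw [← add_shiftOp_add_shiftOp_shiftOp_eq N h9, hf, hf,
    show (3 : ℂ) = 1 + 1 + 1 by norm_num, add_smul, add_smul, one_smul]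

/-- **The `t`-fixed cusp forms of level `Γ₀(N)` are exactly the pull-backs from level `Γ₀(N/3)`**
(`9 ∣ N`): `f ∣ t = f ↔ f ∈ range ι₃` ("`t`-invariant forms are the forms in `q³`"; Lange–Rodríguez
Cor. 3.5.2 (a): `Im f^* = {∑_σ σ(y)}`, the `G`-norms). [cite: LangeRodriguez2022, Cor. 3.5.2 (a) (PDF p. 67)] -/
theorem shiftOp_eq_self_iff_mem_range [NeZero (N / 3)] (f : CuspForm (Gamma0 N) 2) :
    shiftOp N h9 f = f ↔ f ∈ LinearMap.range (degeneracyMap0 (N / 3) N 3 2) := by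
  constructor
  · intro hf
    refine ⟨(3 : ℂ)⁻¹ • adjDegeneracyMap0 N (N / 3) 3 2 f, ?_⟩
    rw [map_smul, ← three_smul_eq_degeneracyMap0_of_shiftOp_eq N h9 hf, smul_smul]
    norm_num
  · rintro ⟨g, rfl⟩
    exact shiftOp_degeneracyMap0 N h9 g

/-- The range of the norm `f ↦ f + f∣t + f∣t²` is the range of `ι₃`. [cite: LangeRodriguez2022, Cor. 3.5.2 (a) (PDF p. 67)] -/
theorem exists_eq_add_shiftOp_add_iff [NeZero (N / 3)] (f : CuspForm (Gamma0 N) 2) :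
    (∃ h : CuspForm (Gamma0 N) 2, f = h + shiftOp N h9 h + shiftOp N h9 (shiftOp N h9 h)) ↔
      f ∈ LinearMap.range (degeneracyMap0 (N / 3) N 3 2) := by
  constructor
  · rintro ⟨h, rfl⟩
    rw [add_shiftOp_add_shiftOp_shiftOp_eq N h9]
    exact LinearMap.mem_range_self _ _
  · rintro ⟨g, rfl⟩
    refine ⟨degeneracyMap0 (N / 3) N 3 2 ((3 : ℂ)⁻¹ • g), ?_⟩
    have hg : adjDegeneracyMap0 N (N / 3) 3 2 (degeneracyMap0 (N / 3) N 3 2 ((3 : ℂ)⁻¹ • g)) = g := by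
      rw [map_smul, map_smul, adjDegeneracyMap0_degeneracyMap0 N h9, smul_smul]
      norm_num
    rw [add_shiftOp_add_shiftOp_shiftOp_eq N h9, hg]

end Forms

/-! ### On the duals `V = S₂(Γ₀(·))^∨`: `Nm = π_*^∨ ∘ ι₃^∨` -/

section Dual

variable (N : ℕ) [NeZero N] (h9 : 3 ^ 2 ∣ N)

/-- **`Nm = π_*^∨ ∘ ι₃^∨` on `V = S₂(Γ₀(N))^∨`**: `normDual φ = π_*^∨ (ι₃^∨ φ)`, the transpose of
`Nm = ι₃ ∘ π_*`. [cite: LangeRodriguez2022, Prop. 3.5.1 (PDF p. 67)] -/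
theorem normDual_eq_dualMap_dualMap [NeZero (N / 3)]
    (φ : Module.Dual ℂ (CuspForm (Gamma0 N) 2)) :
    normDual N h9 φ = (adjDegeneracyMap0 N (N / 3) 3 2).dualMap
      ((degeneracyMap0 (N / 3) N 3 2).dualMap φ) := by
  refine LinearMap.ext fun f ↦ ?_
  simp only [normDual_apply, LinearMap.add_apply, shiftDual_apply, LinearMap.dualMap_apply]
  rw [← add_shiftOp_add_shiftOp_shiftOp_eq N h9, map_add, map_add]
  simp only [shiftOp_apply]

include h9 in
/-- **`ι₃^∨ ∘ π_*^∨ = 3`** on `S₂(Γ₀(N/3))^∨` (transpose of `π_* ι₃ = 3`). [cite: LangeRodriguez2022, §3.2.1 (PDF p. 55)] -/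
theorem dualMap_degeneracyMap0_dualMap_adjDegeneracyMap0 [NeZero (N / 3)]
    (ψ : Module.Dual ℂ (CuspForm (Gamma0 (N / 3)) 2)) :
    (degeneracyMap0 (N / 3) N 3 2).dualMap ((adjDegeneracyMap0 N (N / 3) 3 2).dualMap ψ) =
      (3 : ℂ) • ψ := by
  refine LinearMap.ext fun g ↦ ?_
  rw [LinearMap.dualMap_apply, LinearMap.dualMap_apply, adjDegeneracyMap0_degeneracyMap0 N h9,
    map_smul, LinearMap.smul_apply]

include h9 in
/-- **`π_*^∨ : S₂(Γ₀(N/3))^∨ → S₂(Γ₀(N))^∨` is injective.** [cite: LangeRodriguez2022, §3.2.1 (PDF p. 55)] -/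
theorem dualMap_adjDegeneracyMap0_injective [NeZero (N / 3)] :
    Function.Injective (adjDegeneracyMap0 N (N / 3) 3 2 : CuspForm (Gamma0 N) 2 →ₗ[ℂ] _).dualMap := by
  intro ψ₁ ψ₂ h
  have h' := congrArg (degeneracyMap0 (N / 3) N 3 2).dualMap h
  rw [dualMap_degeneracyMap0_dualMap_adjDegeneracyMap0 N h9,
    dualMap_degeneracyMap0_dualMap_adjDegeneracyMap0 N h9] at h'
  exact smul_right_injective _ (by norm_num : (3 : ℂ) ≠ 0) h'

/-- **`t_*` fixes the image of `π_*^∨`**: `t_* (π_*^∨ ψ) = π_*^∨ ψ` (transpose of `π_* (f∣t) = π_* f`).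
[cite: LangeRodriguez2022, Cor. 3.5.2 (a) (PDF p. 67)] -/
theorem shiftDual_dualMap_adjDegeneracyMap0 [NeZero (N / 3)]
    (ψ : Module.Dual ℂ (CuspForm (Gamma0 (N / 3)) 2)) :
    shiftDual N h9 ((adjDegeneracyMap0 N (N / 3) 3 2).dualMap ψ) =
      (adjDegeneracyMap0 N (N / 3) 3 2).dualMap ψ := by
  refine LinearMap.ext fun f ↦ ?_
  rw [shiftDual_apply, LinearMap.dualMap_apply, LinearMap.dualMap_apply, ← shiftOp_apply,
    adjDegeneracyMap0_shiftOp N h9]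

end Dual

/-! ### Integrality of the transfer `π_*^∨ : H₁(X₀(N/3), ℤ) → H₁(X₀(N), ℤ)` -/

section Transfer

variable (N : ℕ) (h9 : 3 ^ 2 ∣ N)

include h9 in
/-- **The cusp `(1 j; 0 3)·γ∞` is a `Γ₀(N)`-translate of `∞` for `γ ∈ Γ₀(N/3)`, `9 ∣ N`.**  For
`γ = (a b; c d) ∈ Γ₀(N/3)` one has `3 ∣ c`, hence `3 ∤ a + jc`, so `(a + jc, 3c)ᵀ` is a coprime column
with `N ∣ 3c`: it is the first column of some `δ ∈ Γ₀(N)`, and `δ∞ = (a + jc)/(3c) = (γ∞ + j)/3`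
(with `δ∞ = ∞` iff `γ∞ = ∞`).  This is the coset computation `(1 j; 0 3) γ = δ' (1 j'; 0 3)` of
Knapp, Lemma 9.26 / the tree's `exists_tpB_mul_mapGL_eq`, read on cusps as in Cremona §2.4 and the
tree's `exists_gamma0_inftyImage_tpB` (whose input is `γ ∈ Γ₀(N)`; here `γ ∈ Γ₀(N/3)`).
[cite: CremonaAlgorithms1997, §2.4 (2.4.1)–(2.4.2)] -/
theorem exists_gamma0_inftyImage_tpB_of_dvd (γ : Gamma0 (N / 3)) (j : ℤ) :
    ∃ δ : Gamma0 N, ((δ : SL(2, ℤ)) 1 0 = 0 ↔ (γ : SL(2, ℤ)) 1 0 = 0) ∧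
      ((γ : SL(2, ℤ)) 1 0 ≠ 0 →
        ((δ : SL(2, ℤ)) 0 0 : ℚ) / ((δ : SL(2, ℤ)) 1 0 : ℚ) =
          (((γ : SL(2, ℤ)) 0 0 : ℚ) / ((γ : SL(2, ℤ)) 1 0 : ℚ) + j) / 3) := by
  set a : ℤ := (γ : SL(2, ℤ)) 0 0
  set c : ℤ := (γ : SL(2, ℤ)) 1 0
  have hac : IsCoprime a c := Matrix.SpecialLinearGroup.isCoprime_col (γ : SL(2, ℤ)) 0
  have hMc : ((N / 3 : ℕ) : ℤ) ∣ c := dvd_entry_of_mem_Gamma0 (N / 3) γ.2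
  have h3c : (3 : ℤ) ∣ c :=
    (Int.natCast_dvd_natCast.mpr (three_dvd_div_three_of_nine_dvd N h9)).trans hMc
  have hNc : (N : ℤ) ∣ 3 * c := by
    have hN : (N : ℤ) = 3 * ((N / 3 : ℕ) : ℤ) := by
      have h := congrArg (Nat.cast : ℕ → ℤ) (Nat.mul_div_cancel' (three_dvd_of_nine_dvd N h9)).symm
      rw [Nat.cast_mul] at h
      exact h
    rw [hN]
    exact mul_dvd_mul_left 3 hMc
  have hajc : IsCoprime (a + j * c) c := by
    simpa [mul_comm] using hac.add_mul_right_left j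
  have h3P : Prime (3 : ℤ) := Int.prime_three
  have hndvd : ¬ (3 : ℤ) ∣ a + j * c := by
    intro h
    have ha : (3 : ℤ) ∣ a := by simpa using dvd_sub h (h3c.mul_left j)
    exact h3P.not_unit (hac.isUnit_of_dvd' ha h3c)
  have hcop : IsCoprime (a + j * c) (3 * c) :=
    ((h3P.coprime_iff_not_dvd.mpr hndvd).symm).mul_right hajc
  refine ⟨Gamma0.mkOfCol (a + j * c) (3 * c) hcop hNc, by simp [c], fun hc ↦ ?_⟩
  simp only [Gamma0.mkOfCol_apply_zero_zero, Gamma0.mkOfCol_apply_one_zero]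
  have hc' : (c : ℚ) ≠ 0 := by exact_mod_cast hc
  push_cast
  rw [div_add' _ _ _ hc', div_div, mul_comm (c : ℚ) 3]

include h9 in
/-- The modular symbols of `π_* f` (a form of level `N/3`) are those of `U₃ f` (the same function,
viewed at level `N`). [cite: Knapp1993, Lemma 9.26 (PDF p. 216)] -/
theorem modularSymbol_adjDegeneracyMap0 [NeZero N] [NeZero (N / 3)] (f : CuspForm (Gamma0 N) 2)
    (r : ℚ) : modularSymbol (adjDegeneracyMap0 N (N / 3) 3 2 f) r =
      modularSymbol (heckeT (Gamma0 N) 2 3 f) r := by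
  unfold modularSymbol
  rw [coe_adjDegeneracyMap0_of_sq_dvd (N := N) (k := 2) Nat.prime_three
    (three_mul_three_dvd_of_nine_dvd N h9) f]

include h9 in
/-- **`{∞, γ∞}_{π_* f} = ∑_{j mod 3} {∞, δⱼ∞}_f`** for `γ ∈ Γ₀(N/3)`, with `δ₀, δ₁, δ₂ ∈ Γ₀(N)`
depending only on `γ` (`9 ∣ N`): `{∞, r}_{U₃ f} = ∑ⱼ {∞, (r + j)/3}_f` (the tree's
`modularSymbol_heckeT_eq_sum`, Cremona (2.4.1)–(2.4.2)) and each cusp `(γ∞ + j)/3` is `δⱼ∞`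
(`exists_gamma0_inftyImage_tpB_of_dvd`).  This is the transfer `π^* : H₁(X₀(N/3), ℤ) → H₁(X₀(N), ℤ)`
on closed paths. [cite: CremonaAlgorithms1997, §2.4 (2.4.1)–(2.4.2)] -/
theorem exists_cuspSymbol_adjDegeneracyMap0 [NeZero N] [NeZero (N / 3)] (γ : Gamma0 (N / 3)) :
    ∃ δ : Fin 3 → Gamma0 N, ∀ f : CuspForm (Gamma0 N) 2,
      cuspSymbol (adjDegeneracyMap0 N (N / 3) 3 2 f) γ = ∑ j : Fin 3, cuspSymbol f (δ j) := by
  choose δ hδ0 hδ using fun j : Fin 3 ↦ exists_gamma0_inftyImage_tpB_of_dvd N h9 γ ((j : ℕ) : ℤ)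
  refine ⟨δ, fun f ↦ ?_⟩
  by_cases hc : (γ : SL(2, ℤ)) 1 0 = 0
  · rw [cuspSymbol, if_pos hc]
    symm
    exact Finset.sum_eq_zero fun j _ ↦ by rw [cuspSymbol, if_pos ((hδ0 j).mpr hc)]
  · rw [cuspSymbol, if_neg hc, modularSymbol_adjDegeneracyMap0 N h9,
      modularSymbol_heckeT_eq_sum 3 f Nat.prime_three, if_pos (three_dvd_of_nine_dvd N h9), add_zero]
    refine Finset.sum_congr rfl fun j _ ↦ ?_
    rw [cuspSymbol, if_neg (fun h0 ↦ hc ((hδ0 j).mp h0)), hδ j hc]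
    norm_num

include h9 in
/-- **`π_*^∨ {∞, γ∞} = ∑ⱼ {∞, δⱼ∞}`** in `S₂(Γ₀(N))^∨`, for `γ ∈ Γ₀(N/3)` (`9 ∣ N`).
[cite: CremonaAlgorithms1997, §2.4 (2.4.1)–(2.4.2)] -/
theorem exists_dualMap_adjDegeneracyMap0_periodFunctional [NeZero N] [NeZero (N / 3)]
    (γ : Gamma0 (N / 3)) : ∃ δ : Fin 3 → Gamma0 N,
      (adjDegeneracyMap0 N (N / 3) 3 2).dualMap (periodFunctional (N / 3) γ) =
        ∑ j : Fin 3, periodFunctional N (δ j) := by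
  obtain ⟨δ, H⟩ := exists_cuspSymbol_adjDegeneracyMap0 N h9 γ
  refine ⟨δ, LinearMap.ext fun f ↦ ?_⟩
  rw [LinearMap.dualMap_apply, periodFunctional_apply, H f]
  simp

include h9 in
/-- **The transfer is integral**: `π_*^∨` maps `H₁(X₀(N/3), ℤ) ⊆ S₂(Γ₀(N/3))^∨` into
`H₁(X₀(N), ℤ) ⊆ S₂(Γ₀(N))^∨` (`9 ∣ N`) — every integral class at level `N/3` is a single `{∞, γ∞}`
(Cremona, Lemma 2.1.1; the tree's `coe_periodHomology_eq_range`), whose image is a sum of three such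
classes at level `N`. [cite: CremonaAlgorithms1997, §2.1 Lemma 2.1.1 and §2.4] -/
theorem dualMap_adjDegeneracyMap0_mem_periodHomology [NeZero N] [NeZero (N / 3)]
    {ψ : Module.Dual ℂ (CuspForm (Gamma0 (N / 3)) 2)} (hψ : ψ ∈ periodHomology (N / 3)) :
    (adjDegeneracyMap0 N (N / 3) 3 2).dualMap ψ ∈ periodHomology N := by
  have hψ' : ψ ∈ (periodHomology (N / 3) : Set (Module.Dual ℂ (CuspForm (Gamma0 (N / 3)) 2))) := hψ
  rw [coe_periodHomology_eq_range] at hψ'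
  obtain ⟨γ, rfl⟩ := hψ'
  obtain ⟨δ, H⟩ := exists_dualMap_adjDegeneracyMap0_periodFunctional N h9 γ
  rw [H]
  exact AddSubgroup.sum_mem _ fun j _ ↦ periodFunctional_mem_periodHomology N (δ j)

end Transfer

/-! ### On `Λ = H₁(X₀(·), ℤ)`: `π_*`, the transfer `π^*`, and `Nm = π^* π_*` -/

section Lattice

variable (N : ℕ) [NeZero N]

/-- **`π_* : H₁(X₀(N), ℤ) → H₁(X₀(N/3), ℤ)`** (`3 ∣ N`): the restriction of `ι₃^∨` (transpose of the
pull-back of cusp forms along `τ ↦ 3τ`) to the period homology, which it preserves (the tree's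
`dualMap_degeneracyMap0_mem_periodHomology`: `ι₃^∨ {∞, γ∞} = {∞, δ∞}`, `δ = diag(3,1) γ diag(3,1)⁻¹`;
Darmon–Diamond–Taylor Lemma 4.28's `β_{d,*}`). [cite: DarmonDiamondTaylor1995, Lemma 4.28 (p. 135)] -/
def pushforwardInt (h3 : 3 ∣ N) [NeZero (N / 3)] :
    periodHomologyHecke N →ₗ[ℤ] periodHomologyHecke (N / 3) where
  toFun x := ⟨(degeneracyMap0 (N / 3) N 3 2).dualMap x,
    dualMap_degeneracyMap0_mem_periodHomology (N / 3) N 3 (div_three_mul_three_dvd N h3) x.2⟩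
  map_add' x y := by
    apply Subtype.ext
    simp only [Submodule.coe_add, map_add]
  map_smul' n x := by
    apply Subtype.ext
    simp only [Submodule.coe_smul_of_tower, map_zsmul, eq_intCast, Int.cast_id]

/-- The functional underlying `π_* x` is `ι₃^∨ x`. [cite: DarmonDiamondTaylor1995, Lemma 4.28 (p. 135)] -/
@[simp] theorem coe_pushforwardInt (h3 : 3 ∣ N) [NeZero (N / 3)] (x : periodHomologyHecke N) :
    (pushforwardInt N h3 x : Module.Dual ℂ (CuspForm (Gamma0 (N / 3)) 2)) =
      (degeneracyMap0 (N / 3) N 3 2).dualMap x :=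
  rfl

variable (h9 : 3 ^ 2 ∣ N)

include h9 in
/-- **The transfer `π^* : H₁(X₀(N/3), ℤ) → H₁(X₀(N), ℤ)`** (`9 ∣ N`): the restriction of `π_*^∨`
(transpose of the trace `π_* = adjDegeneracyMap0 N (N/3) 3 2`) to the period homology, which it
preserves (`dualMap_adjDegeneracyMap0_mem_periodHomology`). [cite: CremonaAlgorithms1997, §2.4 (2.4.1)–(2.4.2)] -/
def transferInt [NeZero (N / 3)] : periodHomologyHecke (N / 3) →ₗ[ℤ] periodHomologyHecke N where
  toFun y := ⟨(adjDegeneracyMap0 N (N / 3) 3 2).dualMap y,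
    dualMap_adjDegeneracyMap0_mem_periodHomology N h9 y.2⟩
  map_add' x y := by
    apply Subtype.ext
    simp only [Submodule.coe_add, map_add]
  map_smul' n x := by
    apply Subtype.ext
    simp only [Submodule.coe_smul_of_tower, map_zsmul, eq_intCast, Int.cast_id]

/-- The functional underlying `π^* y` is `π_*^∨ y`. [cite: CremonaAlgorithms1997, §2.4 (2.4.1)–(2.4.2)] -/
@[simp] theorem coe_transferInt [NeZero (N / 3)] (y : periodHomologyHecke (N / 3)) :
    (transferInt N h9 y : Module.Dual ℂ (CuspForm (Gamma0 N) 2)) =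
      (adjDegeneracyMap0 N (N / 3) 3 2).dualMap y :=
  rfl

/-- **`Nm = π^* π_*` on `H₁(X₀(N), ℤ)`** (`9 ∣ N`): `transferInt (pushforwardInt x) = normInt x`
(Lange–Rodríguez, Prop. 3.5.1: `Nm_G = f^* ∘ Nm_f`). [cite: LangeRodriguez2022, Prop. 3.5.1 (PDF p. 67)] -/
theorem transferInt_pushforwardInt [NeZero (N / 3)] (x : periodHomologyHecke N) :
    transferInt N h9 (pushforwardInt N (three_dvd_of_nine_dvd N h9) x) = normInt N h9 x := by
  apply Subtype.ext
  rw [coe_transferInt, coe_pushforwardInt, ← normDual_eq_dualMap_dualMap N h9, normInt_apply,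
    normDual_apply]
  simp only [Submodule.coe_add, coe_shiftInt]

/-- `normInt = transferInt ∘ pushforwardInt` as `ℤ`-linear maps. [cite: LangeRodriguez2022, Prop. 3.5.1 (PDF p. 67)] -/
theorem normInt_eq_transferInt_comp_pushforwardInt [NeZero (N / 3)] :
    normInt N h9 = transferInt N h9 ∘ₗ pushforwardInt N (three_dvd_of_nine_dvd N h9) :=
  LinearMap.ext fun x ↦ (transferInt_pushforwardInt N h9 x).symm

/-- **`π_* π^* = 3` on `H₁(X₀(N/3), ℤ)`**: `pushforwardInt (transferInt y) = 3 • y`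
(Lange–Rodríguez §3.2.1: `Nm_f ∘ f^* = d`). [cite: LangeRodriguez2022, §3.2.1 (PDF p. 55)] -/
theorem pushforwardInt_transferInt [NeZero (N / 3)] (y : periodHomologyHecke (N / 3)) :
    pushforwardInt N (three_dvd_of_nine_dvd N h9) (transferInt N h9 y) = 3 • y := by
  apply Subtype.ext
  rw [coe_pushforwardInt, coe_transferInt, dualMap_degeneracyMap0_dualMap_adjDegeneracyMap0 N h9,
    Submodule.coe_smul_of_tower, ← Nat.cast_smul_eq_nsmul ℂ, Nat.cast_ofNat]

/-- **The transfer is injective.** [cite: LangeRodriguez2022, §3.2.1 (PDF p. 55)] -/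
theorem transferInt_injective [NeZero (N / 3)] : Function.Injective (transferInt N h9) :=
  fun _ _ h ↦ Subtype.ext (dualMap_adjDegeneracyMap0_injective N h9 (congrArg Subtype.val h))

/-- **The image of the transfer is `t_*`-fixed**: `shiftInt (transferInt y) = transferInt y`.
[cite: LangeRodriguez2022, Cor. 3.5.2 (a) (PDF p. 67)] -/
theorem shiftInt_transferInt [NeZero (N / 3)] (y : periodHomologyHecke (N / 3)) :
    shiftInt N h9 (transferInt N h9 y) = transferInt N h9 y :=
  Subtype.ext (shiftDual_dualMap_adjDegeneracyMap0 N h9 y)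

/-- The image of the transfer lies in the fixed lattice `Λ_B = ker(t_* − 1)`. [cite: LangeRodriguez2022, Cor. 3.5.2 (a) (PDF p. 67)] -/
theorem transferInt_mem_fixedLattice [NeZero (N / 3)] (y : periodHomologyHecke (N / 3)) :
    transferInt N h9 y ∈ fixedLattice N h9 :=
  (mem_fixedLattice_iff N h9 _).mpr (shiftInt_transferInt N h9 y)

/-- `range transferInt ≤ fixedLattice`. [cite: LangeRodriguez2022, Cor. 3.5.2 (a) (PDF p. 67)] -/
theorem range_transferInt_le_fixedLattice [NeZero (N / 3)] :
    LinearMap.range (transferInt N h9) ≤ fixedLattice N h9 := by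
  rintro _ ⟨y, rfl⟩
  exact transferInt_mem_fixedLattice N h9 y

/-- **`Nm (π^* y) = 3 • π^* y`** (the norm is `3` on `t_*`-fixed classes). [cite: LangeRodriguez2022, §3.2.1 (PDF p. 55)] -/
theorem normInt_transferInt [NeZero (N / 3)] (y : periodHomologyHecke (N / 3)) :
    normInt N h9 (transferInt N h9 y) = 3 • transferInt N h9 y := by
  rw [← transferInt_pushforwardInt N h9, pushforwardInt_transferInt N h9, map_nsmul]

/-- **`Nm Λ_N ⊆ π^* Λ_{N/3}`**. [cite: LangeRodriguez2022, Prop. 3.5.1 (PDF p. 67)] -/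
theorem range_normInt_le_range_transferInt [NeZero (N / 3)] :
    LinearMap.range (normInt N h9) ≤ LinearMap.range (transferInt N h9) := by
  rintro _ ⟨x, rfl⟩
  exact ⟨_, transferInt_pushforwardInt N h9 x⟩

/-- **`3 • π^* Λ_{N/3} ⊆ Nm Λ_N`**: `3 • transferInt y = normInt (transferInt y)`. So `Nm Λ_N` is
sandwiched between `3 • π^*Λ_{N/3}` and `π^*Λ_{N/3} ≅ Λ_{N/3}`. [cite: LangeRodriguez2022, §3.2.1 (PDF p. 55)] -/
theorem three_smul_transferInt_mem_range_normInt [NeZero (N / 3)] (y : periodHomologyHecke (N / 3)) :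
    3 • transferInt N h9 y ∈ LinearMap.range (normInt N h9) :=
  ⟨transferInt N h9 y, normInt_transferInt N h9 y⟩

/-- **`Nm Λ_N ≅ π_* Λ_N` via the transfer**: `normInt x = transferInt y ↔ y = pushforwardInt x`.
[cite: LangeRodriguez2022, Prop. 3.5.1 (PDF p. 67)] -/
theorem normInt_eq_transferInt_iff [NeZero (N / 3)] (x : periodHomologyHecke N)
    (y : periodHomologyHecke (N / 3)) :
    normInt N h9 x = transferInt N h9 y ↔ y = pushforwardInt N (three_dvd_of_nine_dvd N h9) x := by
  rw [← transferInt_pushforwardInt N h9]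
  constructor
  · exact fun h ↦ (transferInt_injective N h9 h).symm
  · rintro rfl; rfl

/-! #### Hecke equivariance away from the level -/

/-- **`π_*` intertwines `T_p` at levels `N` and `N/3`** for primes `p ∤ N`:
`pushforwardInt (T_p • x) = T_p • pushforwardInt x` (transpose of `T_p ι₃ = ι₃ T_p`, the tree's
`heckeT_degeneracyMap0`; Diamond–Shurman Prop. 5.6.2). [cite: DiamondShurman2005, Prop. 5.6.2] -/
theorem pushforwardInt_smul_T (h3 : 3 ∣ N) [NeZero (N / 3)] {p : ℕ} (hp : p.Prime) (hpN : ¬ p ∣ N)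
    (x : periodHomologyHecke N) :
    pushforwardInt N h3 (HeckeRing0.T N 2 p hp • x) =
      HeckeRing0.T (N / 3) 2 p hp • pushforwardInt N h3 x := by
  haveI : NeZero p := ⟨hp.ne_zero⟩
  apply Subtype.ext
  refine LinearMap.ext fun g ↦ ?_
  rw [coe_pushforwardInt, LinearMap.dualMap_apply, coe_smul_apply, coe_smul_apply,
    coe_pushforwardInt, LinearMap.dualMap_apply, HeckeRing0.toEnd_T, HeckeRing0.toEnd_T,
    heckeT_degeneracyMap0 (div_three_mul_three_dvd N h3) hp hpN]

/-- **The transfer intertwines `T_p` at levels `N/3` and `N`** for primes `p ∤ N`: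
`transferInt (T_p • y) = T_p • transferInt y` (transpose of `π_* T_p = T_p π_*`, the tree's
`adjDegeneracyMap0_heckeT`; Diamond–Shurman Prop. 5.6.2). [cite: DiamondShurman2005, Prop. 5.6.2] -/
theorem transferInt_smul_T [NeZero (N / 3)] {p : ℕ} (hp : p.Prime) (hpN : ¬ p ∣ N)
    (y : periodHomologyHecke (N / 3)) :
    transferInt N h9 (HeckeRing0.T (N / 3) 2 p hp • y) =
      HeckeRing0.T N 2 p hp • transferInt N h9 y := by
  haveI : NeZero p := ⟨hp.ne_zero⟩
  apply Subtype.ext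
  refine LinearMap.ext fun f ↦ ?_
  rw [coe_transferInt, LinearMap.dualMap_apply, coe_smul_apply, coe_smul_apply, coe_transferInt,
    LinearMap.dualMap_apply, HeckeRing0.toEnd_T, HeckeRing0.toEnd_T,
    adjDegeneracyMap0_heckeT (div_three_mul_three_dvd N (three_dvd_of_nine_dvd N h9)) hp hpN]

/-- `Nm` commutes with `T_p` for `p ∤ N` through the factorisation `Nm = π^* π_*` (consistency check
with the tree's `normInt_smul_T`, which covers every `p ≠ 3`). [cite: DiamondShurman2005, Prop. 5.6.2] -/
theorem normInt_smul_T_of_not_dvd [NeZero (N / 3)] {p : ℕ} (hp : p.Prime) (hpN : ¬ p ∣ N)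
    (x : periodHomologyHecke N) :
    normInt N h9 (HeckeRing0.T N 2 p hp • x) = HeckeRing0.T N 2 p hp • normInt N h9 x := by
  rw [← transferInt_pushforwardInt N h9, ← transferInt_pushforwardInt N h9,
    pushforwardInt_smul_T N _ hp hpN, transferInt_smul_T N h9 hp hpN]

end Lattice

end Literature.NumberTheory.ModularSymbols

end
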